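import Literature.AnabelianGeometry.AbsoluteAnabelian.AbsTopIII.FrobeniusPictureMLFLogGlueCrossClosure
import Literature.AnabelianGeometry.AbsoluteAnabelian.AbsTopIII.FrobeniusPictureMLFShiftCompatibleModel
import Literature.AnabelianGeometry.AbsoluteAnabelian.AbsTopIII.BiAnabelianModelLiftResidualProofs

/-!
# [AbsTopIII] Cor 3.6 at the MLF model: the Cor-1.10 input datum EXISTS iff `(Π ↷ k̄) ↦ Π` is full on the type
# `P` — i.e. iff the Prop 3.2 (iv) bijectivity (F-2995) holds on `P` with kernels respected

S. Mochizuki, *Topics in Absolute Anabelian Geometry III*, Cor. 3.6 pp. 78–80, Def. 3.1 (iii)/(vi) pp. 67–70,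
Prop. 3.2 (iv) p. 72, Cor. 1.10 pp. 41–44 of the kurims manuscript (`paper:url-5493eb38cbb7`; bib key
`MochizukiAbsTopIII2015`).  Seat abc-iut-L4-t5 (gen 5), row «COR36-MODEL-INPUT» (L4-lead RULING #8e (2)).

The MODEL column of Cor. 3.6 (`TFModel.logFrobeniusCompatible_model` p418071, `logObsCompatCoresStmt_model`
p437324, `shiftCompatStmt_model` p438026, …) is unconditional MODULO the Cor-1.10 datum
`TFModel.AnabelianInput p P D` (`FrobeniusPictureMLFModel.lean`): `alg : 𝒯𝒢^{P} ⥤ 𝒟` ("the group-theoretic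
algorithm of Corollary 1.10"), `forget : 𝒟 ⥤ 𝒳_P`, `algOver : (alg ⋙ forget) ⋙ (𝒳_P → ℰ) ≅ 𝟭`,
`ηAn : (𝒳_P → ℰ) ⋙ (alg ⋙ forget) ≅ 𝟭` — i.e. PRECISELY a quasi-inverse of the projection
`toGalImage p P : 𝒳_P ⥤ ℰ = 𝒯𝒢^{P}`, `(Π ↷ ℚ̄_p) ↦ Π`, onto its essential image.  This file closes the circle,
exactly as abc-iut-L4-t9 did for the lift datum `θ^bi` of Cor. 3.7 (`BiAnabelianModelLiftOfFull.lean`,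
`…ResidualProofs.lean`, whose faithfulness theorem `gal_faithful_of` and fullness characterisations are imported
BY NAME):

* `full_galP_of_anabelianInput` — a Cor-1.10 datum (over ANY `𝒟`) makes `(Π ↷ ℚ̄_p) ↦ Π` FULL on `𝒳_P`;
* `AnabelianInput.ofFull` — conversely, from FULLNESS on `𝒳_P` (faithfulness being abc-iut-L4-t9's theorem,
  Prop. 3.2 (iv) injectivity at the model) the canonical datum with `𝒟 := 𝒳_P`, `alg :=` the quasi-inverse;
* `AnabelianInput.ofGaloisIsoLifts` — hence from the PRINTED residual: kernels of `Π ↠ Aut(ℚ̄_p)` respected by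
  the group isomorphisms on `P`, and the Prop. 3.2 (iv) `TF`-bijectivity schema F-2995
  `GaloisIsoLiftsToTFPairIsoOfStrictlyBelyi` at the predicate "is the pair of a `P`-object" (abc-iut-L4-t9's
  `full_ι_gal_iff_ker_and_galoisIsoLiftsToTFPairIso`);
* `isEmpty_anabelianInput_slim` — consistency: over the type "`Π_k` slim" NO Cor-1.10 datum exists (abc-iut-L4-t9's
  swap object: slimness alone is not "strictly Belyi type"), as print expects;
* the Cor. 3.6 model column re-based on the printed residual: `logFrobeniusCompatible_model_of_galoisIsoLifts`,
  `logObsCompatCoresStmt_model_of_galoisIsoLifts`, `shiftCompatStmt_model_of_galoisIsoLifts` (and the `_of_full`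
  forms).

HONEST SCOPE.  Fullness / F-2995 on `P` is NOT proved: it is the absolute ("Isom-rigidity") anabelian content —
false for the bare MLF pairs `(G_k ↷ ℚ̄_p)` of non-isomorphic MLF's with isomorphic absolute Galois groups
(Jarden–Ritter, Yamagata), [AbsTopIII] Cor. 1.10 / Prop. 3.2 (iv) for print's `𝒞^{MLF-sB}`; it is the
`TFModel`-side form of binder (B1) `Cor_1_10_iii.exists_ringEquiv_compatible` of abc-iut-w5-d058's COR110iii
census (necessity p435491, `CurveModel` side) — campaign-L.  No new `Prop` fact (F-2995 is a registered named
fact, consumed BY NAME; `Functor.Full` is Mathlib's).  One definition (`ofFull`; `ofGaloisIsoLifts` unfolds to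
it).  Refereed pre-IUT material; nothing here bears on [IUTchIII] Cor. 3.12; model-level ≠ node-level.
-/

noncomputable section

namespace Literature.AnabelianGeometry.AbsoluteAnabelian.AbsTopIII

open CategoryTheory
open Literature.AlgebraicGeometry.Frobenioids (IsSlimGroup)

namespace TFModel

variable (p : ℕ) [Fact p.Prime] (P : ObjectProperty (TFModel p))

/-! ### A Cor-1.10 datum forces fullness -/

variable {p P} in
/-- **A Cor-1.10 datum makes `𝒳_P → ℰ` an equivalence**: `alg ⋙ forget` is a quasi-inverse (`η_An⁻¹` the unit,
`algOver` the counit). [cite: MochizukiAbsTopIII2015, Corollary 3.6 (ii) p.79] -/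
theorem toGalImage_isEquivalence_of_anabelianInput {D : Type 1} [Category.{1} D] (I : AnabelianInput p P D) :
    (toGalImage p P).IsEquivalence :=
  Functor.IsEquivalence.mk' (I.alg ⋙ I.forget) I.ηAn.symm I.algOver

variable {p P} in
/-- **A Cor-1.10 datum makes `(Π ↷ ℚ̄_p) ↦ Π` FULL on `𝒳_P`** (every isomorphism of topological groups between the
`Π` of two `P`-objects is the group component of a Galois-isomorphism of pairs — the Prop. 3.2 (iv)
bijectivity SHAPE). [cite: MochizukiAbsTopIII2015, Proposition 3.2 (iv) p.72] -/
theorem full_galP_of_anabelianInput {D : Type 1} [Category.{1} D] (I : AnabelianInput p P D) :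
    (galP p P).Full := by
  haveI := toGalImage_isEquivalence_of_anabelianInput I
  haveI : ((galP p P).toEssImage ⋙ (galP p P).essImage.ι).Full := Functor.Full.comp _ _
  exact Functor.Full.of_iso (galP p P).toEssImageCompι

/-! ### The Cor-1.10 datum from fullness (faithfulness is abc-iut-L4-t9's Prop. 3.2 (iv) injectivity) -/

/-- `𝒳_P → ℰ` is faithful (abc-iut-L4-t9's `gal_faithful_of`, through the essential image).
[cite: MochizukiAbsTopIII2015, Proposition 3.2 (iv) p.72] -/
theorem toGalImage_faithful : (toGalImage p P).Faithful := by
  haveI := gal_faithful_of (p := p) P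
  exact inferInstance

/-- Under fullness `𝒳_P → ℰ` is an equivalence (full, faithful, essentially surjective by construction).
[cite: MochizukiAbsTopIII2015, Corollary 3.6 (ii) p.79] -/
theorem toGalImage_isEquivalence_of_full (hfull : (galP p P).Full) : (toGalImage p P).IsEquivalence := by
  haveI := hfull
  haveI := toGalImage_faithful p P
  exact {}

/-- **The Cor-1.10 input datum of Cor. 3.6 FROM FULLNESS of `(Π ↷ ℚ̄_p) ↦ Π` on `𝒳_P`**: `𝒟 := 𝒳_P`, `alg :=`
the quasi-inverse `ℰ ⥤ 𝒳_P` of the (then) equivalence `toGalImage`, `forget := 𝟭`, `algOver` / `η_An` := its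
counit / inverse unit.  (The Cor. 3.6 analogue of abc-iut-L4-t9's `biAnabelianLiftOfFull` for Cor. 3.7.)
[cite: MochizukiAbsTopIII2015, Corollary 3.6 (ii) p.79] -/
def AnabelianInput.ofFull (hfull : (galP p P).Full) : AnabelianInput p P P.FullSubcategory :=
  haveI := toGalImage_isEquivalence_of_full p P hfull
  { alg := (toGalImage p P).inv
    forget := 𝟭 _
    algOver := Functor.isoWhiskerRight ((toGalImage p P).inv.rightUnitor) (toGalImage p P) ≪≫
      (toGalImage p P).asEquivalence.counitIso
    ηAn := Functor.isoWhiskerLeft (toGalImage p P) ((toGalImage p P).inv.rightUnitor) ≪≫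
      (toGalImage p P).asEquivalence.unitIso.symm }

/-- **The Cor-1.10 input datum FROM THE PRINTED RESIDUAL**: kernels of `Π ↠ Aut(ℚ̄_p)` respected by the
isomorphisms of topological groups between `P`-objects, and the Prop. 3.2 (iv) `TF`-bijectivity schema
(F-2995 `GaloisIsoLiftsToTFPairIsoOfStrictlyBelyi`) at the predicate "is the pair of a `P`-object" — via
abc-iut-L4-t9's `full_ι_gal_iff_ker_and_galoisIsoLiftsToTFPairIso`.
[cite: MochizukiAbsTopIII2015, Proposition 3.2 (iv) p.72] -/
def AnabelianInput.ofGaloisIsoLifts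
    (hker : ∀ A B : TFModel p, P A → P B → ∀ f : A.pair.Pi ≃ₜ* B.pair.Pi,
      A.pair.actionKer.map f.toMulEquiv.toMonoidHom = B.pair.actionKer)
    (hlift : GaloisIsoLiftsToTFPairIsoOfStrictlyBelyi (fun Q => ∃ A : TFModel p, P A ∧ A.pair = Q)) :
    AnabelianInput p P P.FullSubcategory :=
  AnabelianInput.ofFull p P ((full_ι_gal_iff_ker_and_galoisIsoLiftsToTFPairIso P).mpr ⟨hker, hlift⟩)

/-- **Consistency: over the type "`Π_k` slim" there is NO Cor-1.10 datum, for any `𝒟`** — fullness fails there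
(abc-iut-L4-t9's `not_full_gal_slim`: the factor swap of `G × G` does not lift), as print expects (slimness
alone is not "strictly Belyi type"). [cite: MochizukiAbsTopIII2015, Proposition 3.2 (iv) p.72] -/
theorem isEmpty_anabelianInput_slim {D : Type 1} [Category.{1} D] :
    IsEmpty (AnabelianInput p (fun A : TFModel p => IsSlimGroup A.pair.Pi) D) :=
  ⟨fun I => not_full_gal_slim p (full_galP_of_anabelianInput I)⟩

/-! ### The Cor. 3.6 model column re-based on fullness / on the printed residual -/

variable {p P}

/-- **[AbsTopIII] Cor. 3.6 (i)–(v) AT THE MLF MODEL, from fullness** on a type `P` of slim pairs with an object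
`x₀`: the assembled `LogFrobeniusCompatible` for the model data with the datum `AnabelianInput.ofFull`
(abc-iut-L4-t5 gen 4's `logFrobeniusCompatible_model`). [cite: MochizukiAbsTopIII2015, Corollary 3.6 (i)–(v) pp.78–80] -/
theorem logFrobeniusCompatible_model_of_full (hfull : (galP p P).Full)
    (hP : ∀ A : TFModel p, P A → IsSlimGroup A.pair.Pi) (x₀ : P.FullSubcategory) :
    (monoAnabelianData (AnabelianInput.ofFull p P hfull)).toLogFrobeniusData.LogFrobeniusCompatible
      (monoAnabelianData (AnabelianInput.ofFull p P hfull)).telecoreData :=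
  logFrobeniusCompatible_model hP _ x₀

/-- **[AbsTopIII] Cor. 3.6 (iii), second clause (cores), AT THE MLF MODEL, from fullness** (abc-iut-w5-d053's
`logObsCompatCoresStmt_model`). [cite: MochizukiAbsTopIII2015, Corollary 3.6 (iii) p.80] -/
theorem logObsCompatCoresStmt_model_of_full (hfull : (galP p P).Full) :
    (monoAnabelianData (AnabelianInput.ofFull p P hfull)).toLogFrobeniusData.LogObsCompatCoresStmt :=
  logObsCompatCoresStmt_model _

/-- **[AbsTopIII] Cor. 3.6 (v), third sentence, AT THE MLF MODEL, from fullness** (abc-iut-w6-d023's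
`shiftCompatStmt_model`). [cite: MochizukiAbsTopIII2015, Corollary 3.6 (v) p.80] -/
theorem shiftCompatStmt_model_of_full (hfull : (galP p P).Full) :
    (monoAnabelianData (AnabelianInput.ofFull p P hfull)).toLogFrobeniusData.ShiftCompatStmt :=
  shiftCompatStmt_model _

/-- **[AbsTopIII] Cor. 3.6 (i)–(v) AT THE MLF MODEL, from the printed residual** (kernels respected on `P` +
F-2995 on `P`; slimness; one object). [cite: MochizukiAbsTopIII2015, Corollary 3.6 (i)–(v) pp.78–80] -/
theorem logFrobeniusCompatible_model_of_galoisIsoLifts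
    (hker : ∀ A B : TFModel p, P A → P B → ∀ f : A.pair.Pi ≃ₜ* B.pair.Pi,
      A.pair.actionKer.map f.toMulEquiv.toMonoidHom = B.pair.actionKer)
    (hlift : GaloisIsoLiftsToTFPairIsoOfStrictlyBelyi (fun Q => ∃ A : TFModel p, P A ∧ A.pair = Q))
    (hP : ∀ A : TFModel p, P A → IsSlimGroup A.pair.Pi) (x₀ : P.FullSubcategory) :
    (monoAnabelianData (AnabelianInput.ofGaloisIsoLifts p P hker hlift)).toLogFrobeniusData.LogFrobeniusCompatible
      (monoAnabelianData (AnabelianInput.ofGaloisIsoLifts p P hker hlift)).telecoreData :=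
  logFrobeniusCompatible_model hP _ x₀

/-- **[AbsTopIII] Cor. 3.6 (iii), second clause (cores), AT THE MLF MODEL, from the printed residual.**
[cite: MochizukiAbsTopIII2015, Corollary 3.6 (iii) p.80] -/
theorem logObsCompatCoresStmt_model_of_galoisIsoLifts
    (hker : ∀ A B : TFModel p, P A → P B → ∀ f : A.pair.Pi ≃ₜ* B.pair.Pi,
      A.pair.actionKer.map f.toMulEquiv.toMonoidHom = B.pair.actionKer)
    (hlift : GaloisIsoLiftsToTFPairIsoOfStrictlyBelyi (fun Q => ∃ A : TFModel p, P A ∧ A.pair = Q)) :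
    (monoAnabelianData (AnabelianInput.ofGaloisIsoLifts p P hker hlift)).toLogFrobeniusData.LogObsCompatCoresStmt :=
  logObsCompatCoresStmt_model _

/-- **[AbsTopIII] Cor. 3.6 (v), third sentence, AT THE MLF MODEL, from the printed residual.**
[cite: MochizukiAbsTopIII2015, Corollary 3.6 (v) p.80] -/
theorem shiftCompatStmt_model_of_galoisIsoLifts
    (hker : ∀ A B : TFModel p, P A → P B → ∀ f : A.pair.Pi ≃ₜ* B.pair.Pi,
      A.pair.actionKer.map f.toMulEquiv.toMonoidHom = B.pair.actionKer)
    (hlift : GaloisIsoLiftsToTFPairIsoOfStrictlyBelyi (fun Q => ∃ A : TFModel p, P A ∧ A.pair = Q)) :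
    (monoAnabelianData (AnabelianInput.ofGaloisIsoLifts p P hker hlift)).toLogFrobeniusData.ShiftCompatStmt :=
  shiftCompatStmt_model _

/-! ### The Cor-1.10 datum of Cor. 3.6 and the lift datum `θ^bi` of Cor. 3.7 are EQUIVALENT inputs at the model -/

variable (p P)

/-- **The Cor-1.10 datum of Cor. 3.6 exists over `𝒳_P` (with `𝒟 := 𝒳_P`) iff `(Π ↷ ℚ̄_p) ↦ Π` is full on
`𝒳_P`.** [cite: MochizukiAbsTopIII2015, Corollary 3.6 (ii) p.79] -/
theorem nonempty_anabelianInput_iff_full :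
    Nonempty (AnabelianInput p P P.FullSubcategory) ↔ (galP p P).Full :=
  ⟨fun ⟨I⟩ => full_galP_of_anabelianInput I, fun h => ⟨AnabelianInput.ofFull p P h⟩⟩

/-- **… iff kernels are respected on `P` and the Prop. 3.2 (iv) `TF`-bijectivity schema F-2995 holds on `P`**
(the printed residual, via abc-iut-L4-t9's `full_ι_gal_iff_ker_and_galoisIsoLiftsToTFPairIso`).
[cite: MochizukiAbsTopIII2015, Proposition 3.2 (iv) p.72] -/
theorem nonempty_anabelianInput_iff_ker_and_galoisIsoLiftsToTFPairIso :
    Nonempty (AnabelianInput p P P.FullSubcategory) ↔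
      (∀ A B : TFModel p, P A → P B → ∀ f : A.pair.Pi ≃ₜ* B.pair.Pi,
          A.pair.actionKer.map f.toMulEquiv.toMonoidHom = B.pair.actionKer) ∧
      GaloisIsoLiftsToTFPairIsoOfStrictlyBelyi (fun Q => ∃ A : TFModel p, P A ∧ A.pair = Q) :=
  (nonempty_anabelianInput_iff_full p P).trans (full_ι_gal_iff_ker_and_galoisIsoLiftsToTFPairIso P)

/-- **The Cor-1.10 input datum of Cor. 3.6 and the bi-anabelian lift datum `θ^bi` of Cor. 3.7 (ii) are
EQUIVALENT data at the MLF model** (both ⟺ fullness of `(Π ↷ ℚ̄_p) ↦ Π` on `𝒳_P`; abc-iut-L4-t9's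
`nonempty_biAnabelianLift_iff_full`): print derives both from "the 'group-theoretic' algorithms of
Corollary 1.10" (Cor. 3.6 (ii) p. 79; Cor. 3.7 (ii) p. 87, "the bi-anabelian portion").
[cite: MochizukiAbsTopIII2015, Corollary 3.7 (ii) p.87] -/
theorem nonempty_anabelianInput_iff_nonempty_biAnabelianLift :
    Nonempty (AnabelianInput p P P.FullSubcategory) ↔
      Nonempty (FiberSquare.BiAnabelianLift ((modelSetting p).restrict P fun _ h => h).gal) :=
  (nonempty_anabelianInput_iff_full p P).trans (nonempty_biAnabelianLift_iff_full P).symm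

end TFModel

end Literature.AnabelianGeometry.AbsoluteAnabelian.AbsTopIII

end
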